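import Summits.CriticalPhenomena.PercolationContinuityZ3.Theorems.PercNearOneGluingNoHeavyLowerTailHubPairApex
import HarnessLib

/-!
# `NoHeavyLowerTail` (stmt-CriticalPhenomena-4575) — HUB PAIRS WITH THE APEX ALONE ON ITS SIDE, part 3:
# the Θ-identity ⇒ R1 from six far-side blocks (every `q > 0`)

Support file (prover prim-gen-kcluster gen 72; `--supports stmt-CriticalPhenomena-4575`).  No definitions, no named facts, no sorries.
Notation of parts 1–2 (`…HubPairApexGlue`, `…HubPairApex`).  This file supplies the partition bits of the five reference blocks (`bits_A … bits_E`),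
the replacement property of the four R1 cells (`rep_cells`, `rep_S`), the vanishing of the rows `B, E` on the cells (`row_vanish`,
`cells_empty_of_isolated`: with `a` joined to no hub the reference configuration has `C(a) = {a}`), and the conclusion

**THEOREM** (`HubPairApex.r1_of_blocks`).  Let the apex arm `DA ∋ a` meet the rest `DY ∋ b, c` only in the hubs `h₁ ≠ h₂` (`a ≠ h₁, h₂, b, c`; `a` on no
pair of `DY`; `b, c` on pairs of `DA` only as hubs; `c ∈ cl DY b`).  With the reference functionals `R_s(E)` of part 2 (`s = A, C, D`; `E` = the cells
`T, U_b, U_c` and the separating cell for the support `{ah₁, ah₂, h₁h₂} ∪ DY`), if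
`Q_A, Q_C, Q_D ≥ 0` (`Q_s = R_s(U_b)R_s(U_c) − R_s(T)R_s(S)`), `W⁰ = X[R_A,R_C] ≥ 0`, `W¹ = X[R_A,R_D] ≥ 0`, `CROSS = X[R_C,R_D] ≥ 0`
(`X[u,v] = U_b^u U_c^v + U_b^v U_c^u − T^u S^v − T^v S^u`), then R1 holds for `(a; b, c)` on `rcMeasureW w q ∅` with support `D = DA ∪ DY`, every `q > 0`:
`K²(Z(U_b)Z(U_c) − Z(T)Z(S)) = X_A²Q_A + X_C²Q_C + X_D²Q_D + X_AX_C W⁰ + X_AX_D W¹ + X_CX_D CROSS ≥ 0` (the Θ-IDENTITY of KCLUSTER-gen65 §0.1 with an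
ARBITRARY far side).  `R_C`, `R_D` are the free three-point cells of the far side at apex `h₁`, `h₂` (the pendant pair `ah` only relabels the apex) and
`R_A` its `{h₁,h₂}`-wired cells, so `Q_C, Q_D, Q_A` are R1 slacks of smaller instances and `CROSS`, `W⁰`, `W¹` are gen 57's / gen 65's cross forms:
**a minimal counterexample to R1-RC(q) has no 2-cut isolating the apex unless CROSS or W fails on the far side.**
-/

noncomputable section

namespace Summit.CriticalPhenomena.PercolationContinuityZ3.Theorems

namespace HubPairApex

open Finset SimpleGraph Literature.Probability.Percolation Literature.Probability.Percolation.Gladkov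
open Literature.Probability.Percolation.BHK2006 (weight)
open Literature.Probability.Percolation.DecisionTree (ind ind_of_mem ind_of_not_mem ind_nonneg)
open Literature.Probability.LatticeModels RefinedRowR3 ThreePointLB APL MeasureTheory
open scoped Classical

variable {V : Type*} [Fintype V]

/-! ### The reference blocks: partition bits and vanishing rows -/

section Gadget

variable {a h₁ h₂ : V} (h12 : h₁ ≠ h₂) (ha1 : a ≠ h₁) (ha2 : a ≠ h₂)
include h12 ha1 ha2

omit h12 in
/-- Bits of the reference block `g_A = {ah₁, ah₂}`. [this work] -/
theorem bits_A : ({s(a, h₁), s(a, h₂)} : Set (Sym2 V)) ∈ {η : BondConfig V | h₁ ∈ cl η.toFinset a} ∧ ({s(a, h₁), s(a, h₂)} : Set (Sym2 V)) ∈ {η : BondConfig V | h₂ ∈ cl η.toFinset a} ∧ ({s(a, h₁), s(a, h₂)} : Set (Sym2 V)) ∈ {η : BondConfig V | h₂ ∈ cl η.toFinset h₁} := by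
  simp only [Set.mem_setOf_eq, Set.toFinset_insert, Set.toFinset_singleton]
  have e1 : h₁ ∈ cl ({s(a, h₁), s(a, h₂)} : Finset (Sym2 V)) a :=
    mem_cl_of_adj (mem_cl_self _ a) (by rw [openGraph_adj, Finset.mem_coe]; exact ⟨by simp, ha1⟩)
  have e2 : h₂ ∈ cl ({s(a, h₁), s(a, h₂)} : Finset (Sym2 V)) a :=
    mem_cl_of_adj (mem_cl_self _ a) (by rw [openGraph_adj, Finset.mem_coe]; exact ⟨by simp, ha2⟩)
  exact ⟨e1, e2, mem_cl_trans (mem_cl_comm.1 e1) e2⟩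

/-- Bits of the reference block `g_C = {ah₁}`. [this work] -/
theorem bits_C : ({s(a, h₁)} : Set (Sym2 V)) ∈ {η : BondConfig V | h₁ ∈ cl η.toFinset a} ∧ ({s(a, h₁)} : Set (Sym2 V)) ∉ {η : BondConfig V | h₂ ∈ cl η.toFinset a} ∧ ({s(a, h₁)} : Set (Sym2 V)) ∉ {η : BondConfig V | h₂ ∈ cl η.toFinset h₁} := by
  simp only [Set.mem_setOf_eq, Set.toFinset_singleton]
  have e1 : h₁ ∈ cl ({s(a, h₁)} : Finset (Sym2 V)) a :=
    mem_cl_of_adj (mem_cl_self _ a) (by rw [openGraph_adj, Finset.mem_coe]; exact ⟨by simp, ha1⟩)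
  have e2 : h₂ ∉ cl ({s(a, h₁)} : Finset (Sym2 V)) a := fun h => by
    obtain ⟨e, he, h2e⟩ := exists_mem_edge_of_mem_cl h ha2.symm
    rw [Finset.mem_singleton] at he; subst he
    exact (Sym2.mem_iff.1 h2e).elim (fun h' => ha2 h'.symm) (fun h' => h12 h'.symm)
  exact ⟨e1, e2, fun h => e2 (mem_cl_trans e1 h)⟩

/-- Bits of the reference block `g_D = {ah₂}`. [this work] -/
theorem bits_D : ({s(a, h₂)} : Set (Sym2 V)) ∉ {η : BondConfig V | h₁ ∈ cl η.toFinset a} ∧ ({s(a, h₂)} : Set (Sym2 V)) ∈ {η : BondConfig V | h₂ ∈ cl η.toFinset a} ∧ ({s(a, h₂)} : Set (Sym2 V)) ∉ {η : BondConfig V | h₂ ∈ cl η.toFinset h₁} := by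
  simp only [Set.mem_setOf_eq, Set.toFinset_singleton]
  have e2 : h₂ ∈ cl ({s(a, h₂)} : Finset (Sym2 V)) a :=
    mem_cl_of_adj (mem_cl_self _ a) (by rw [openGraph_adj, Finset.mem_coe]; exact ⟨by simp, ha2⟩)
  have e1 : h₁ ∉ cl ({s(a, h₂)} : Finset (Sym2 V)) a := fun h => by
    obtain ⟨e, he, h1e⟩ := exists_mem_edge_of_mem_cl h ha1.symm
    rw [Finset.mem_singleton] at he; subst he
    exact (Sym2.mem_iff.1 h1e).elim (fun h' => ha1 h'.symm) (fun h' => h12 h')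
  exact ⟨e1, e2, fun h => e1 (mem_cl_trans e2 (mem_cl_comm.1 h))⟩

/-- Bits of the reference block `g_B = {h₁h₂}`. [this work] -/
theorem bits_B : ({s(h₁, h₂)} : Set (Sym2 V)) ∉ {η : BondConfig V | h₁ ∈ cl η.toFinset a} ∧ ({s(h₁, h₂)} : Set (Sym2 V)) ∉ {η : BondConfig V | h₂ ∈ cl η.toFinset a} ∧ ({s(h₁, h₂)} : Set (Sym2 V)) ∈ {η : BondConfig V | h₂ ∈ cl η.toFinset h₁} := by
  simp only [Set.mem_setOf_eq, Set.toFinset_singleton]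
  have h0 : ∀ e ∈ ({s(h₁, h₂)} : Finset (Sym2 V)), a ∉ e := fun e he hae => by
    rw [Finset.mem_singleton] at he; subst he
    exact (Sym2.mem_iff.1 hae).elim ha1 ha2
  exact ⟨fun h => ha1 (ApexTwoSum.eq_of_mem_cl_of_forall_not_mem h0 h).symm,
    fun h => ha2 (ApexTwoSum.eq_of_mem_cl_of_forall_not_mem h0 h).symm,
    mem_cl_of_adj (mem_cl_self _ h₁) (by rw [openGraph_adj, Finset.mem_coe]; exact ⟨by simp, h12⟩)⟩

/-- Bits of the reference block `g_E = ∅`. [this work] -/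
theorem bits_E : (∅ : Set (Sym2 V)) ∉ {η : BondConfig V | h₁ ∈ cl η.toFinset a} ∧ (∅ : Set (Sym2 V)) ∉ {η : BondConfig V | h₂ ∈ cl η.toFinset a} ∧ (∅ : Set (Sym2 V)) ∉ {η : BondConfig V | h₂ ∈ cl η.toFinset h₁} := by
  simp only [Set.mem_setOf_eq, Set.toFinset_empty]
  exact ⟨NetworkFold.not_mem_cl_empty ha1, NetworkFold.not_mem_cl_empty ha2, NetworkFold.not_mem_cl_empty h12⟩

end Gadget

/-! ### The Θ-identity and R1 -/

section Main

variable {DA DY D : Finset (Sym2 V)} {a h₁ h₂ b c : V} (h12 : h₁ ≠ h₂) (ha1 : a ≠ h₁) (ha2 : a ≠ h₂) (hab : a ≠ b) (hac : a ≠ c)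
  (hsepD : ∀ z : V, (∃ e ∈ DA, z ∈ e) → (∃ e ∈ DY, z ∈ e) → (z = h₁ ∨ z = h₂)) (haY : ∀ e ∈ DY, a ∉ e)
  (hb : ∀ e ∈ DA, b ∈ e → (b = h₁ ∨ b = h₂)) (hc : ∀ e ∈ DA, c ∈ e → (c = h₁ ∨ c = h₂)) (hbc : c ∈ cl DY b)
  (hD : ∀ e, e ∈ D ↔ e ∈ DA ∨ e ∈ DY)
  (w wA wY : Sym2 V → unitInterval) {q : ℝ} (hq : 0 < q)
  (hw : ∀ e, e ∉ (↑DA ∪ ↑DY : Set (Sym2 V)) → (w e : ℝ) = 0)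
  (hX : ∀ e ∈ (↑DA : Set (Sym2 V)), wA e = w e) (hX' : ∀ e ∉ (↑DA : Set (Sym2 V)), wA e = 0)
  (hY : ∀ e ∈ (↑DA : Set (Sym2 V)), wY e = 0) (hY' : ∀ e ∉ (↑DA : Set (Sym2 V)), wY e = w e)

include hsepD haY hb hc in
/-- Replacement property of the cells `T, U_b, U_c` for a reference block with the right bits. [this work] -/
theorem rep_cells {ω g : BondConfig V} (hω : ω ⊆ ↑DA ∪ ↑DY) (hg : g ⊆ (↑({s(a, h₁), s(a, h₂), s(h₁, h₂)} : Finset (Sym2 V)) : Set (Sym2 V)))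
    (hP1 : (ω ∩ ↑DA) ∈ {η : BondConfig V | h₁ ∈ cl η.toFinset a} ↔ g ∈ {η : BondConfig V | h₁ ∈ cl η.toFinset a}) (hP2 : (ω ∩ ↑DA) ∈ {η : BondConfig V | h₂ ∈ cl η.toFinset a} ↔ g ∈ {η : BondConfig V | h₂ ∈ cl η.toFinset a}) (hP12 : (ω ∩ ↑DA) ∈ {η : BondConfig V | h₂ ∈ cl η.toFinset h₁} ↔ g ∈ {η : BondConfig V | h₂ ∈ cl η.toFinset h₁}) :
    (ω ∈ {η : BondConfig V | b ∈ cl η.toFinset a ∧ c ∈ cl η.toFinset a} ↔ g ∪ (ω \ ↑DA) ∈ {η : BondConfig V | b ∈ cl η.toFinset a ∧ c ∈ cl η.toFinset a}) ∧ (ω ∈ {η : BondConfig V | b ∈ cl η.toFinset a ∧ c ∉ cl η.toFinset a} ↔ g ∪ (ω \ ↑DA) ∈ {η : BondConfig V | b ∈ cl η.toFinset a ∧ c ∉ cl η.toFinset a}) ∧ (ω ∈ {η : BondConfig V | b ∉ cl η.toFinset a ∧ c ∈ cl η.toFinset a} ↔ g ∪ (ω \ ↑DA) ∈ {η : BondConfig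 V | b ∉ cl η.toFinset a ∧ c ∈ cl η.toFinset a}) := by
  have eb := mem_cl_iff_ref hsepD haY (x := a) (y := b) (fun _ _ _ => Or.inl rfl) (fun e he hbe => Or.inr (hb e he hbe)) hω hg hP1 hP2 hP12
  have ec := mem_cl_iff_ref hsepD haY (x := a) (y := c) (fun _ _ _ => Or.inl rfl) (fun e he hce => Or.inr (hc e he hce)) hω hg hP1 hP2 hP12
  simp only [Set.mem_setOf_eq] at eb ec ⊢
  rw [eb, ec]
  exact ⟨Iff.rfl, Iff.rfl, Iff.rfl⟩

include h12 hab hac hsepD haY hb hc hbc in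
/-- Replacement property of the separating cell. [this work] -/
theorem rep_S {ω g : BondConfig V} (hω : ω ⊆ ↑DA ∪ ↑DY) (hg : g ⊆ (↑({s(a, h₁), s(a, h₂), s(h₁, h₂)} : Finset (Sym2 V)) : Set (Sym2 V)))
    (hP1 : (ω ∩ ↑DA) ∈ {η : BondConfig V | h₁ ∈ cl η.toFinset a} ↔ g ∈ {η : BondConfig V | h₁ ∈ cl η.toFinset a}) (hP2 : (ω ∩ ↑DA) ∈ {η : BondConfig V | h₂ ∈ cl η.toFinset a} ↔ g ∈ {η : BondConfig V | h₂ ∈ cl η.toFinset a}) (hP12 : (ω ∩ ↑DA) ∈ {η : BondConfig V | h₂ ∈ cl η.toFinset h₁} ↔ g ∈ {η : BondConfig V | h₂ ∈ cl η.toFinset h₁}) :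
    ω ∈ {η : BondConfig V | b ∉ cl η.toFinset a ∧ c ∉ cl η.toFinset a ∧ Sep (DA ∪ DY) (cl η.toFinset a) b c} ↔ g ∪ (ω \ ↑DA) ∈ {η : BondConfig V | b ∉ cl η.toFinset a ∧ c ∉ cl η.toFinset a ∧ Sep (({s(a, h₁), s(a, h₂), s(h₁, h₂)} : Finset (Sym2 V)) ∪ DY) (cl η.toFinset a) b c} := by
  have eb := mem_cl_iff_ref hsepD haY (x := a) (y := b) (fun _ _ _ => Or.inl rfl) (fun e he hbe => Or.inr (hb e he hbe)) hω hg hP1 hP2 hP12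
  have ec := mem_cl_iff_ref hsepD haY (x := a) (y := c) (fun _ _ _ => Or.inl rfl) (fun e he hce => Or.inr (hc e he hce)) hω hg hP1 hP2 hP12
  have es := sep_iff_ref h12 hsepD haY hab hac hb hc hbc hω hg hP1 hP2 hP12
  simp only [Set.mem_setOf_eq] at eb ec es ⊢
  rw [eb, ec, es]

omit [Fintype V] in
/-- The reference blocks lie in the reference arm. [folklore] -/
theorem g_sub : ({s(a, h₁), s(a, h₂)} : Set (Sym2 V)) ⊆ (↑({s(a, h₁), s(a, h₂), s(h₁, h₂)} : Finset (Sym2 V)) : Set (Sym2 V)) ∧ ({s(h₁, h₂)} : Set (Sym2 V)) ⊆ (↑({s(a, h₁), s(a, h₂), s(h₁, h₂)} : Finset (Sym2 V)) : Set (Sym2 V)) ∧ ({s(a, h₁)} : Set (Sym2 V)) ⊆ (↑({s(a, h₁), s(a, h₂), s(h₁, h₂)} : Finset (Sym2 V)) : Set (Sym2 V)) ∧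
    ({s(a, h₂)} : Set (Sym2 V)) ⊆ (↑({s(a, h₁), s(a, h₂), s(h₁, h₂)} : Finset (Sym2 V)) : Set (Sym2 V)) ∧ (∅ : Set (Sym2 V)) ⊆ (↑({s(a, h₁), s(a, h₂), s(h₁, h₂)} : Finset (Sym2 V)) : Set (Sym2 V)) := by
  simp only [Finset.coe_insert, Finset.coe_singleton]
  refine ⟨?_, ?_, ?_, ?_, Set.empty_subset _⟩
  · intro e he; rcases he with rfl | rfl
    · exact Or.inl rfl
    · exact Or.inr (Or.inl rfl)
  · intro e he; rw [Set.mem_singleton_iff] at he; subst he; exact Or.inr (Or.inr rfl)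
  · intro e he; rw [Set.mem_singleton_iff] at he; subst he; exact Or.inl rfl
  · intro e he; rw [Set.mem_singleton_iff] at he; subst he; exact Or.inr (Or.inl rfl)

include hw hY hY' in
/-- A row whose reference block never produces the event does not charge it. [this work] -/
theorem row_vanish (g : BondConfig V) (f : BondConfig V → ℝ) {E : Set (BondConfig V)}
    (hE : ∀ η : BondConfig V, η ⊆ ↑DY → g ∪ η ∉ E) :
    ∑ η : BondConfig V, rcWeightW wY q ({h₁, h₂} : Set V) η * (ind {η : BondConfig V | g ∪ η ∈ E} η * f η) = 0 := by
  refine Finset.sum_eq_zero fun η _ => ?_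
  by_cases hη : η ⊆ ↑DY
  · have h1 : η ∉ {η : BondConfig V | g ∪ η ∈ E} := hE η hη
    rw [ind_of_not_mem h1]; ring
  · obtain ⟨e, heη, heY⟩ := Set.not_subset.1 hη
    have hwY : ∀ e', e' ∉ (↑DY : Set (Sym2 V)) → (wY e' : ℝ) = 0 := by
      intro e' he'
      by_cases heA : e' ∈ (↑DA : Set (Sym2 V))
      · rw [hY e' heA]; rfl
      · rw [hY' e' heA]; exact hw e' (fun h => h.elim heA he')
    have h0 := ApexTwoSum.weight_eq_zero_of_mem_not_mem wY hwY heη heY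
    unfold rcWeightW
    rw [h0]; ring

include hab hac haY hbc in
/-- In the rows `B` and `E` (`a` joined to no hub) the reference configuration has `C(a) = {a}`: no R1 cell occurs. [this work] -/
theorem cells_empty_of_isolated (g : BondConfig V) (hga : ∀ e ∈ g, a ∉ e) (η : BondConfig V) (hη : η ⊆ ↑DY) :
    g ∪ η ∉ {η : BondConfig V | b ∈ cl η.toFinset a ∧ c ∈ cl η.toFinset a} ∧ g ∪ η ∉ {η : BondConfig V | b ∈ cl η.toFinset a ∧ c ∉ cl η.toFinset a} ∧ g ∪ η ∉ {η : BondConfig V | b ∉ cl η.toFinset a ∧ c ∈ cl η.toFinset a} ∧ g ∪ η ∉ {η : BondConfig V | b ∉ cl η.toFinset a ∧ c ∉ cl η.toFinset a ∧ Sep (({s(a, h₁), s(a, h₂), s(h₁, h₂)} : Finset (Sym2 V)) ∪ DY) (cl η.toFinset a) b c} := by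
  suffices key : ∀ ζ : Finset (Sym2 V), (∀ e, e ∈ ζ ↔ e ∈ g ∪ η) →
      (b ∉ cl ζ a ∧ c ∉ cl ζ a ∧ ¬ Sep (({s(a, h₁), s(a, h₂), s(h₁, h₂)} : Finset (Sym2 V)) ∪ DY) (cl ζ a) b c) by
    refine ⟨fun h => ?_, fun h => ?_, fun h => ?_, fun h => ?_⟩
    · exact (key _ (fun e => by simp only [Set.mem_toFinset])).1 h.1
    · exact (key _ (fun e => by simp only [Set.mem_toFinset])).1 h.1
    · exact (key _ (fun e => by simp only [Set.mem_toFinset])).2.1 h.2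
    · exact (key _ (fun e => by simp only [Set.mem_toFinset])).2.2 h.2.2
  intro ζ hζ
  have h0 : ∀ e ∈ ζ, a ∉ e := fun e he => by
    rw [hζ] at he
    exact he.elim (hga e) (fun h => haY e (hη h))
  have hbn : b ∉ cl ζ a := fun h => hab (ApexTwoSum.eq_of_mem_cl_of_forall_not_mem h0 h).symm
  have hcn : c ∉ cl ζ a := fun h => hac (ApexTwoSum.eq_of_mem_cl_of_forall_not_mem h0 h).symm
  have hsub : DY ⊆ (({s(a, h₁), s(a, h₂), s(h₁, h₂)} : Finset (Sym2 V)) ∪ DY) \ touch (cl ζ a) := fun e he =>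
    Finset.mem_sdiff.2 ⟨Finset.mem_union_right _ he, fun ht => by
      obtain ⟨z, hzW, hze⟩ := mem_touch.1 ht
      have hz := ApexTwoSum.eq_of_mem_cl_of_forall_not_mem h0 hzW
      exact haY e he (hz ▸ hze)⟩
  refine ⟨hbn, hcn, fun hs => ?_⟩
  unfold RefinedRowR3.Sep at hs
  exact hs (cl_mono hsub b hbc)

omit [Fintype V] in
/-- **The abstract Θ-identity**: a three-term quadratic form with non-negative diagonal blocks (`Q_A, Q_C, Q_D`) and polar blocks
(`W⁰, W¹, CROSS`) is non-negative on the positive orthant (the rows `B, E` carry zero cells). [this work] -/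
theorem theta_quadratic_le {XA XB XC XD XE aT aS aB aC cT cS cB cC dT dS dB dC : ℝ}
    (hXA : 0 ≤ XA) (hXC : 0 ≤ XC) (hXD : 0 ≤ XD)
    (hQA : aT * aS ≤ aB * aC) (hQC : cT * cS ≤ cB * cC) (hQD : dT * dS ≤ dB * dC)
    (hW0 : aT * cS + cT * aS ≤ aB * cC + cB * aC) (hW1 : aT * dS + dT * aS ≤ aB * dC + dB * aC)
    (hCR : cT * dS + dT * cS ≤ cB * dC + dB * cC) :
    (XA * aT + XB * 0 + XC * cT + XD * dT + XE * 0) * (XA * aS + XB * 0 + XC * cS + XD * dS + XE * 0) ≤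
      (XA * aB + XB * 0 + XC * cB + XD * dB + XE * 0) * (XA * aC + XB * 0 + XC * cC + XD * dC + XE * 0) := by
  rw [← sub_nonneg]
  have key : (XA * aB + XB * 0 + XC * cB + XD * dB + XE * 0) * (XA * aC + XB * 0 + XC * cC + XD * dC + XE * 0) -
      (XA * aT + XB * 0 + XC * cT + XD * dT + XE * 0) * (XA * aS + XB * 0 + XC * cS + XD * dS + XE * 0) =
      XA * XA * (aB * aC - aT * aS) + XC * XC * (cB * cC - cT * cS) + XD * XD * (dB * dC - dT * dS) +
        XA * XC * (aB * cC + cB * aC - (aT * cS + cT * aS)) + XA * XD * (aB * dC + dB * aC - (aT * dS + dT * aS)) +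
        XC * XD * (cB * dC + dB * cC - (cT * dS + dT * cS)) := by ring
  rw [key]
  have h1 := mul_nonneg (mul_nonneg hXA hXA) (sub_nonneg.2 hQA)
  have h2 := mul_nonneg (mul_nonneg hXC hXC) (sub_nonneg.2 hQC)
  have h3 := mul_nonneg (mul_nonneg hXD hXD) (sub_nonneg.2 hQD)
  have h4 := mul_nonneg (mul_nonneg hXA hXC) (sub_nonneg.2 hW0)
  have h5 := mul_nonneg (mul_nonneg hXA hXD) (sub_nonneg.2 hW1)
  have h6 := mul_nonneg (mul_nonneg hXC hXD) (sub_nonneg.2 hCR)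
  linarith

include h12 ha1 ha2 hab hac hsepD haY hb hc hbc hD hq hw hX hX' hY hY' in
/-- **The Θ-identity ⇒ R1** (every `q > 0`; see the module docstring). [this work] -/
theorem r1_of_blocks
    (hQA : (∑ η : BondConfig V, rcWeightW wY q ({h₁, h₂} : Set V) η * ind {η : BondConfig V | ({s(a, h₁), s(a, h₂)} : Set (Sym2 V)) ∪ η ∈ {η : BondConfig V | b ∈ cl η.toFinset a ∧ c ∈ cl η.toFinset a}} η) * (∑ η : BondConfig V, rcWeightW wY q ({h₁, h₂} : Set V) η * ind {η : BondConfig V | ({s(a, h₁), s(a, h₂)} : Set (Sym2 V)) ∪ η ∈ {η : BondConfig V | b ∉ cl η.toFinset a ∧ c ∉ cl η.toFinset a ∧ Sep (({s(a, h₁), s(a, h₂), s(h₁, h₂)} : Finset (Sym2 V)) ∪ DY) (cl η.toFinset a) b c}} η) ≤ (∑ η : BondConfig V, rcWeightW wY q ({h₁, h₂} : Set V) η * ind {η : BondConfig V | ({s(a, h₁), s(a, h₂)} : Set (Sym2 V)) ∪ η ∈ {η : BondConfig V | b ∈ cl η.toFinset a ∧ c ∉ cl η.toFinset a}} η) * (∑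 η : BondConfig V, rcWeightW wY q ({h₁, h₂} : Set V) η * ind {η : BondConfig V | ({s(a, h₁), s(a, h₂)} : Set (Sym2 V)) ∪ η ∈ {η : BondConfig V | b ∉ cl η.toFinset a ∧ c ∈ cl η.toFinset a}} η)) (hQC : (∑ η : BondConfig V, rcWeightW wY q ({h₁, h₂} : Set V) η * (ind {η : BondConfig V | ({s(a, h₁)} : Set (Sym2 V)) ∪ η ∈ {η : BondConfig V | b ∈ cl η.toFinset a ∧ c ∈ cl η.toFinset a}} η * (if η ∈ {η : BondConfig V | h₂ ∈ cl η.toFinset h₁} then 1 else q))) * (∑ η : BondConfig V, rcWeightW wY q ({h₁, h₂} : Set V) η * (ind {η : BondConfig V | ({s(a, h₁)} : Set (Sym2 V)) ∪ η ∈ {η : BondConfig V | b ∉ cl η.toFinset a ∧ c ∉ cl η.toFinset a ∧ Sep (({s(a, h₁), s(a, h₂), s(h₁, h₂)} : Finset (Sym2 V)) ∪ DY) (cl η.toFinset a) b c}} η * (if η ∈ {η : BondConfig V | h₂ ∈ cl η.toFinset h₁} then 1 else q))) ≤ (∑ η : BondConfig V, rcWeightW wY q ({h₁, h₂} : Set V)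 η * (ind {η : BondConfig V | ({s(a, h₁)} : Set (Sym2 V)) ∪ η ∈ {η : BondConfig V | b ∈ cl η.toFinset a ∧ c ∉ cl η.toFinset a}} η * (if η ∈ {η : BondConfig V | h₂ ∈ cl η.toFinset h₁} then 1 else q))) * (∑ η : BondConfig V, rcWeightW wY q ({h₁, h₂} : Set V) η * (ind {η : BondConfig V | ({s(a, h₁)} : Set (Sym2 V)) ∪ η ∈ {η : BondConfig V | b ∉ cl η.toFinset a ∧ c ∈ cl η.toFinset a}} η * (if η ∈ {η : BondConfig V | h₂ ∈ cl η.toFinset h₁} then 1 else q)))) (hQD : (∑ η : BondConfig V, rcWeightW wY q ({h₁, h₂} : Set V) η * (ind {η : BondConfig V | ({s(a, h₂)} : Set (Sym2 V)) ∪ η ∈ {η : BondConfig V | b ∈ cl η.toFinset a ∧ c ∈ cl η.toFinset a}} η * (if η ∈ {η : BondConfig V | h₂ ∈ cl η.toFinset h₁} then 1 else q))) * (∑ η : BondConfig V, rcWeightW wY q ({h₁, h₂} : Set V) η * (ind {η : BondConfig V | ({s(a, h₂)} : Set (Sym2 V)) ∪ η ∈ {η : BondConfig V | b ∉ cl η.toFinset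 a ∧ c ∉ cl η.toFinset a ∧ Sep (({s(a, h₁), s(a, h₂), s(h₁, h₂)} : Finset (Sym2 V)) ∪ DY) (cl η.toFinset a) b c}} η * (if η ∈ {η : BondConfig V | h₂ ∈ cl η.toFinset h₁} then 1 else q))) ≤ (∑ η : BondConfig V, rcWeightW wY q ({h₁, h₂} : Set V) η * (ind {η : BondConfig V | ({s(a, h₂)} : Set (Sym2 V)) ∪ η ∈ {η : BondConfig V | b ∈ cl η.toFinset a ∧ c ∉ cl η.toFinset a}} η * (if η ∈ {η : BondConfig V | h₂ ∈ cl η.toFinset h₁} then 1 else q))) * (∑ η : BondConfig V, rcWeightW wY q ({h₁, h₂} : Set V) η * (ind {η : BondConfig V | ({s(a, h₂)} : Set (Sym2 V)) ∪ η ∈ {η : BondConfig V | b ∉ cl η.toFinset a ∧ c ∈ cl η.toFinset a}} η * (if η ∈ {η : BondConfig V | h₂ ∈ cl η.toFinset h₁} then 1 else q))))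
    (hW0 : (∑ η : BondConfig V, rcWeightW wY q ({h₁, h₂} : Set V) η * ind {η : BondConfig V | ({s(a, h₁), s(a, h₂)} : Set (Sym2 V)) ∪ η ∈ {η : BondConfig V | b ∈ cl η.toFinset a ∧ c ∈ cl η.toFinset a}} η) * (∑ η : BondConfig V, rcWeightW wY q ({h₁, h₂} : Set V) η * (ind {η : BondConfig V | ({s(a, h₁)} : Set (Sym2 V)) ∪ η ∈ {η : BondConfig V | b ∉ cl η.toFinset a ∧ c ∉ cl η.toFinset a ∧ Sep (({s(a, h₁), s(a, h₂), s(h₁, h₂)} : Finset (Sym2 V)) ∪ DY) (cl η.toFinset a) b c}} η * (if η ∈ {η : BondConfig V | h₂ ∈ cl η.toFinset h₁} then 1 else q))) + (∑ η : BondConfig V, rcWeightW wY q ({h₁, h₂} : Set V) η * (ind {η : BondConfig V | ({s(a, h₁)} : Set (Sym2 V)) ∪ η ∈ {η : BondConfig V | b ∈ cl η.toFinset a ∧ c ∈ cl η.toFinset a}} η * (if η ∈ {η : BondConfig V | h₂ ∈ cl η.toFinset h₁} then 1 else q))) * (∑ η : BondConfig V, rcWeightW wY q ({h₁, h₂} :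 Set V) η * ind {η : BondConfig V | ({s(a, h₁), s(a, h₂)} : Set (Sym2 V)) ∪ η ∈ {η : BondConfig V | b ∉ cl η.toFinset a ∧ c ∉ cl η.toFinset a ∧ Sep (({s(a, h₁), s(a, h₂), s(h₁, h₂)} : Finset (Sym2 V)) ∪ DY) (cl η.toFinset a) b c}} η) ≤ (∑ η : BondConfig V, rcWeightW wY q ({h₁, h₂} : Set V) η * ind {η : BondConfig V | ({s(a, h₁), s(a, h₂)} : Set (Sym2 V)) ∪ η ∈ {η : BondConfig V | b ∈ cl η.toFinset a ∧ c ∉ cl η.toFinset a}} η) * (∑ η : BondConfig V, rcWeightW wY q ({h₁, h₂} : Set V) η * (ind {η : BondConfig V | ({s(a, h₁)} : Set (Sym2 V)) ∪ η ∈ {η : BondConfig V | b ∉ cl η.toFinset a ∧ c ∈ cl η.toFinset a}} η * (if η ∈ {η : BondConfig V | h₂ ∈ cl η.toFinset h₁} then 1 else q))) + (∑ η : BondConfig V, rcWeightW wY q ({h₁, h₂} : Set V) η * (ind {η : BondConfig V | ({s(a, h₁)} : Set (Sym2 V)) ∪ η ∈ {η : BondConfig V | b ∈ cl η.toFinset a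 ∧ c ∉ cl η.toFinset a}} η * (if η ∈ {η : BondConfig V | h₂ ∈ cl η.toFinset h₁} then 1 else q))) * (∑ η : BondConfig V, rcWeightW wY q ({h₁, h₂} : Set V) η * ind {η : BondConfig V | ({s(a, h₁), s(a, h₂)} : Set (Sym2 V)) ∪ η ∈ {η : BondConfig V | b ∉ cl η.toFinset a ∧ c ∈ cl η.toFinset a}} η))
    (hW1 : (∑ η : BondConfig V, rcWeightW wY q ({h₁, h₂} : Set V) η * ind {η : BondConfig V | ({s(a, h₁), s(a, h₂)} : Set (Sym2 V)) ∪ η ∈ {η : BondConfig V | b ∈ cl η.toFinset a ∧ c ∈ cl η.toFinset a}} η) * (∑ η : BondConfig V, rcWeightW wY q ({h₁, h₂} : Set V) η * (ind {η : BondConfig V | ({s(a, h₂)} : Set (Sym2 V)) ∪ η ∈ {η : BondConfig V | b ∉ cl η.toFinset a ∧ c ∉ cl η.toFinset a ∧ Sep (({s(a, h₁), s(a, h₂), s(h₁, h₂)} : Finset (Sym2 V)) ∪ DY) (cl η.toFinset a) b c}} η * (if η ∈ {η : BondConfig V | h₂ ∈ cl η.toFinset h₁} then 1 else q))) + (∑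 η : BondConfig V, rcWeightW wY q ({h₁, h₂} : Set V) η * (ind {η : BondConfig V | ({s(a, h₂)} : Set (Sym2 V)) ∪ η ∈ {η : BondConfig V | b ∈ cl η.toFinset a ∧ c ∈ cl η.toFinset a}} η * (if η ∈ {η : BondConfig V | h₂ ∈ cl η.toFinset h₁} then 1 else q))) * (∑ η : BondConfig V, rcWeightW wY q ({h₁, h₂} : Set V) η * ind {η : BondConfig V | ({s(a, h₁), s(a, h₂)} : Set (Sym2 V)) ∪ η ∈ {η : BondConfig V | b ∉ cl η.toFinset a ∧ c ∉ cl η.toFinset a ∧ Sep (({s(a, h₁), s(a, h₂), s(h₁, h₂)} : Finset (Sym2 V)) ∪ DY) (cl η.toFinset a) b c}} η) ≤ (∑ η : BondConfig V, rcWeightW wY q ({h₁, h₂} : Set V) η * ind {η : BondConfig V | ({s(a, h₁), s(a, h₂)} : Set (Sym2 V)) ∪ η ∈ {η : BondConfig V | b ∈ cl η.toFinset a ∧ c ∉ cl η.toFinset a}} η) * (∑ η : BondConfig V, rcWeightW wY q ({h₁, h₂} : Set V) η * (ind {η : BondConfig V | ({s(a, h₂)} : Set (Sym2 V)) ∪ η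 ∈ {η : BondConfig V | b ∉ cl η.toFinset a ∧ c ∈ cl η.toFinset a}} η * (if η ∈ {η : BondConfig V | h₂ ∈ cl η.toFinset h₁} then 1 else q))) + (∑ η : BondConfig V, rcWeightW wY q ({h₁, h₂} : Set V) η * (ind {η : BondConfig V | ({s(a, h₂)} : Set (Sym2 V)) ∪ η ∈ {η : BondConfig V | b ∈ cl η.toFinset a ∧ c ∉ cl η.toFinset a}} η * (if η ∈ {η : BondConfig V | h₂ ∈ cl η.toFinset h₁} then 1 else q))) * (∑ η : BondConfig V, rcWeightW wY q ({h₁, h₂} : Set V) η * ind {η : BondConfig V | ({s(a, h₁), s(a, h₂)} : Set (Sym2 V)) ∪ η ∈ {η : BondConfig V | b ∉ cl η.toFinset a ∧ c ∈ cl η.toFinset a}} η))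
    (hCR : (∑ η : BondConfig V, rcWeightW wY q ({h₁, h₂} : Set V) η * (ind {η : BondConfig V | ({s(a, h₁)} : Set (Sym2 V)) ∪ η ∈ {η : BondConfig V | b ∈ cl η.toFinset a ∧ c ∈ cl η.toFinset a}} η * (if η ∈ {η : BondConfig V | h₂ ∈ cl η.toFinset h₁} then 1 else q))) * (∑ η : BondConfig V, rcWeightW wY q ({h₁, h₂} : Set V) η * (ind {η : BondConfig V | ({s(a, h₂)} : Set (Sym2 V)) ∪ η ∈ {η : BondConfig V | b ∉ cl η.toFinset a ∧ c ∉ cl η.toFinset a ∧ Sep (({s(a, h₁), s(a, h₂), s(h₁, h₂)} : Finset (Sym2 V)) ∪ DY) (cl η.toFinset a) b c}} η * (if η ∈ {η : BondConfig V | h₂ ∈ cl η.toFinset h₁} then 1 else q))) + (∑ η : BondConfig V, rcWeightW wY q ({h₁, h₂} : Set V) η * (ind {η : BondConfig V | ({s(a, h₂)} : Set (Sym2 V)) ∪ η ∈ {η : BondConfig V | b ∈ cl η.toFinset a ∧ c ∈ cl η.toFinset a}} η * (if η ∈ {η : BondConfig V | h₂ ∈ cl η.toFinset h₁} then 1 else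 q))) * (∑ η : BondConfig V, rcWeightW wY q ({h₁, h₂} : Set V) η * (ind {η : BondConfig V | ({s(a, h₁)} : Set (Sym2 V)) ∪ η ∈ {η : BondConfig V | b ∉ cl η.toFinset a ∧ c ∉ cl η.toFinset a ∧ Sep (({s(a, h₁), s(a, h₂), s(h₁, h₂)} : Finset (Sym2 V)) ∪ DY) (cl η.toFinset a) b c}} η * (if η ∈ {η : BondConfig V | h₂ ∈ cl η.toFinset h₁} then 1 else q))) ≤ (∑ η : BondConfig V, rcWeightW wY q ({h₁, h₂} : Set V) η * (ind {η : BondConfig V | ({s(a, h₁)} : Set (Sym2 V)) ∪ η ∈ {η : BondConfig V | b ∈ cl η.toFinset a ∧ c ∉ cl η.toFinset a}} η * (if η ∈ {η : BondConfig V | h₂ ∈ cl η.toFinset h₁} then 1 else q))) * (∑ η : BondConfig V, rcWeightW wY q ({h₁, h₂} : Set V) η * (ind {η : BondConfig V | ({s(a, h₂)} : Set (Sym2 V)) ∪ η ∈ {η : BondConfig V | b ∉ cl η.toFinset a ∧ c ∈ cl η.toFinset a}} η * (if η ∈ {η : BondConfig V | h₂ ∈ cl η.toFinset h₁} then 1 else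 q))) + (∑ η : BondConfig V, rcWeightW wY q ({h₁, h₂} : Set V) η * (ind {η : BondConfig V | ({s(a, h₂)} : Set (Sym2 V)) ∪ η ∈ {η : BondConfig V | b ∈ cl η.toFinset a ∧ c ∉ cl η.toFinset a}} η * (if η ∈ {η : BondConfig V | h₂ ∈ cl η.toFinset h₁} then 1 else q))) * (∑ η : BondConfig V, rcWeightW wY q ({h₁, h₂} : Set V) η * (ind {η : BondConfig V | ({s(a, h₁)} : Set (Sym2 V)) ∪ η ∈ {η : BondConfig V | b ∉ cl η.toFinset a ∧ c ∈ cl η.toFinset a}} η * (if η ∈ {η : BondConfig V | h₂ ∈ cl η.toFinset h₁} then 1 else q)))) :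
    (rcMeasureW w q ∅).real {η : BondConfig V | b ∈ cl η.toFinset a ∧ c ∈ cl η.toFinset a} * (rcMeasureW w q ∅).real {η : BondConfig V | b ∉ cl η.toFinset a ∧ c ∉ cl η.toFinset a ∧ Sep D (cl η.toFinset a) b c} ≤ (rcMeasureW w q ∅).real {η : BondConfig V | b ∈ cl η.toFinset a ∧ c ∉ cl η.toFinset a} * (rcMeasureW w q ∅).real {η : BondConfig V | b ∉ cl η.toFinset a ∧ c ∈ cl η.toFinset a} := by
  have hDD : D = DA ∪ DY := by ext e; rw [Finset.mem_union]; exact hD e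
  subst hDD
  have hZ := rcPartitionFunctionW_pos w hq (∅ : Set V)
  have hK : 0 < q ^ clusterCount (∅ : BondConfig V) ({h₁, h₂} : Set V) := pow_pos hq _
  have gs := g_sub (V := V) (a := a) (h₁ := h₁) (h₂ := h₂)
  have bA := bits_A (V := V) ha1 ha2
  have bB := bits_B (V := V) h12 ha1 ha2
  have bC := bits_C (V := V) h12 ha1 ha2
  have bD := bits_D (V := V) h12 ha1 ha2
  have bE := bits_E (V := V) (a := a) h12 ha1 ha2
  have mA : ∀ {ω : BondConfig V}, (ω ∩ ↑DA) ∈ {η : BondConfig V | h₁ ∈ cl η.toFinset a ∧ h₂ ∈ cl η.toFinset a} →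
      (((ω ∩ ↑DA) ∈ {η : BondConfig V | h₁ ∈ cl η.toFinset a} ↔ ({s(a, h₁), s(a, h₂)} : Set (Sym2 V)) ∈ {η : BondConfig V | h₁ ∈ cl η.toFinset a}) ∧ ((ω ∩ ↑DA) ∈ {η : BondConfig V | h₂ ∈ cl η.toFinset a} ↔ ({s(a, h₁), s(a, h₂)} : Set (Sym2 V)) ∈ {η : BondConfig V | h₂ ∈ cl η.toFinset a}) ∧ ((ω ∩ ↑DA) ∈ {η : BondConfig V | h₂ ∈ cl η.toFinset h₁} ↔ ({s(a, h₁), s(a, h₂)} : Set (Sym2 V)) ∈ {η : BondConfig V | h₂ ∈ cl η.toFinset h₁})) := fun h =>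
    ⟨iff_of_true h.1 bA.1, iff_of_true h.2 bA.2.1, iff_of_true (mem_cl_trans (mem_cl_comm.1 h.1) h.2) bA.2.2⟩
  have mC : ∀ {ω : BondConfig V}, (ω ∩ ↑DA) ∈ {η : BondConfig V | h₁ ∈ cl η.toFinset a ∧ h₂ ∉ cl η.toFinset a} →
      (((ω ∩ ↑DA) ∈ {η : BondConfig V | h₁ ∈ cl η.toFinset a} ↔ ({s(a, h₁)} : Set (Sym2 V)) ∈ {η : BondConfig V | h₁ ∈ cl η.toFinset a}) ∧ ((ω ∩ ↑DA) ∈ {η : BondConfig V | h₂ ∈ cl η.toFinset a} ↔ ({s(a, h₁)} : Set (Sym2 V)) ∈ {η : BondConfig V | h₂ ∈ cl η.toFinset a}) ∧ ((ω ∩ ↑DA) ∈ {η : BondConfig V | h₂ ∈ cl η.toFinset h₁} ↔ ({s(a, h₁)} : Set (Sym2 V)) ∈ {η : BondConfig V | h₂ ∈ cl η.toFinset h₁})) := fun h =>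
    ⟨iff_of_true h.1 bC.1, iff_of_false h.2 bC.2.1, iff_of_false (fun hj => h.2 (mem_cl_trans h.1 hj)) bC.2.2⟩
  have mD : ∀ {ω : BondConfig V}, (ω ∩ ↑DA) ∈ {η : BondConfig V | h₁ ∉ cl η.toFinset a ∧ h₂ ∈ cl η.toFinset a} →
      (((ω ∩ ↑DA) ∈ {η : BondConfig V | h₁ ∈ cl η.toFinset a} ↔ ({s(a, h₂)} : Set (Sym2 V)) ∈ {η : BondConfig V | h₁ ∈ cl η.toFinset a}) ∧ ((ω ∩ ↑DA) ∈ {η : BondConfig V | h₂ ∈ cl η.toFinset a} ↔ ({s(a, h₂)} : Set (Sym2 V)) ∈ {η : BondConfig V | h₂ ∈ cl η.toFinset a}) ∧ ((ω ∩ ↑DA) ∈ {η : BondConfig V | h₂ ∈ cl η.toFinset h₁} ↔ ({s(a, h₂)} : Set (Sym2 V)) ∈ {η : BondConfig V | h₂ ∈ cl η.toFinset h₁})) := fun h =>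
    ⟨iff_of_false h.1 bD.1, iff_of_true h.2 bD.2.1, iff_of_false (fun hj => h.1 (mem_cl_trans h.2 (mem_cl_comm.1 hj))) bD.2.2⟩
  have mB : ∀ {ω : BondConfig V}, (ω ∩ ↑DA) ∈ {η : BondConfig V | h₁ ∉ cl η.toFinset a ∧ h₂ ∉ cl η.toFinset a ∧ h₂ ∈ cl η.toFinset h₁} →
      (((ω ∩ ↑DA) ∈ {η : BondConfig V | h₁ ∈ cl η.toFinset a} ↔ ({s(h₁, h₂)} : Set (Sym2 V)) ∈ {η : BondConfig V | h₁ ∈ cl η.toFinset a}) ∧ ((ω ∩ ↑DA) ∈ {η : BondConfig V | h₂ ∈ cl η.toFinset a} ↔ ({s(h₁, h₂)} : Set (Sym2 V)) ∈ {η : BondConfig V | h₂ ∈ cl η.toFinset a}) ∧ ((ω ∩ ↑DA) ∈ {η : BondConfig V | h₂ ∈ cl η.toFinset h₁} ↔ ({s(h₁, h₂)} : Set (Sym2 V)) ∈ {η : BondConfig V | h₂ ∈ cl η.toFinset h₁})) := fun h =>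
    ⟨iff_of_false h.1 bB.1, iff_of_false h.2.1 bB.2.1, iff_of_true h.2.2 bB.2.2⟩
  have mE : ∀ {ω : BondConfig V}, (ω ∩ ↑DA) ∈ {η : BondConfig V | h₁ ∉ cl η.toFinset a ∧ h₂ ∉ cl η.toFinset a ∧ h₂ ∉ cl η.toFinset h₁} →
      (((ω ∩ ↑DA) ∈ {η : BondConfig V | h₁ ∈ cl η.toFinset a} ↔ (∅ : Set (Sym2 V)) ∈ {η : BondConfig V | h₁ ∈ cl η.toFinset a}) ∧ ((ω ∩ ↑DA) ∈ {η : BondConfig V | h₂ ∈ cl η.toFinset a} ↔ (∅ : Set (Sym2 V)) ∈ {η : BondConfig V | h₂ ∈ cl η.toFinset a}) ∧ ((ω ∩ ↑DA) ∈ {η : BondConfig V | h₂ ∈ cl η.toFinset h₁} ↔ (∅ : Set (Sym2 V)) ∈ {η : BondConfig V | h₂ ∈ cl η.toFinset h₁})) := fun h =>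
    ⟨iff_of_false h.1 bE.1, iff_of_false h.2.1 bE.2.1, iff_of_false h.2.2 bE.2.2⟩
  have eT := sum_eq (q := q) h12 hsepD w wA wY hw hX hX' hY hY' (EG := {η : BondConfig V | b ∈ cl η.toFinset a ∧ c ∈ cl η.toFinset a}) (E := {η : BondConfig V | b ∈ cl η.toFinset a ∧ c ∈ cl η.toFinset a})
    (fun ω hω hs => (rep_cells hsepD haY hb hc hω gs.1 (mA hs).1 (mA hs).2.1 (mA hs).2.2).1)
    (fun ω hω hs => (rep_cells hsepD haY hb hc hω gs.2.1 (mB hs).1 (mB hs).2.1 (mB hs).2.2).1)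
    (fun ω hω hs => (rep_cells hsepD haY hb hc hω gs.2.2.1 (mC hs).1 (mC hs).2.1 (mC hs).2.2).1)
    (fun ω hω hs => (rep_cells hsepD haY hb hc hω gs.2.2.2.1 (mD hs).1 (mD hs).2.1 (mD hs).2.2).1)
    (fun ω hω hs => (rep_cells hsepD haY hb hc hω gs.2.2.2.2 (mE hs).1 (mE hs).2.1 (mE hs).2.2).1)
  have eUb := sum_eq (q := q) h12 hsepD w wA wY hw hX hX' hY hY' (EG := {η : BondConfig V | b ∈ cl η.toFinset a ∧ c ∉ cl η.toFinset a}) (E := {η : BondConfig V | b ∈ cl η.toFinset a ∧ c ∉ cl η.toFinset a})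
    (fun ω hω hs => (rep_cells hsepD haY hb hc hω gs.1 (mA hs).1 (mA hs).2.1 (mA hs).2.2).2.1)
    (fun ω hω hs => (rep_cells hsepD haY hb hc hω gs.2.1 (mB hs).1 (mB hs).2.1 (mB hs).2.2).2.1)
    (fun ω hω hs => (rep_cells hsepD haY hb hc hω gs.2.2.1 (mC hs).1 (mC hs).2.1 (mC hs).2.2).2.1)
    (fun ω hω hs => (rep_cells hsepD haY hb hc hω gs.2.2.2.1 (mD hs).1 (mD hs).2.1 (mD hs).2.2).2.1)
    (fun ω hω hs => (rep_cells hsepD haY hb hc hω gs.2.2.2.2 (mE hs).1 (mE hs).2.1 (mE hs).2.2).2.1)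
  have eUc := sum_eq (q := q) h12 hsepD w wA wY hw hX hX' hY hY' (EG := {η : BondConfig V | b ∉ cl η.toFinset a ∧ c ∈ cl η.toFinset a}) (E := {η : BondConfig V | b ∉ cl η.toFinset a ∧ c ∈ cl η.toFinset a})
    (fun ω hω hs => (rep_cells hsepD haY hb hc hω gs.1 (mA hs).1 (mA hs).2.1 (mA hs).2.2).2.2)
    (fun ω hω hs => (rep_cells hsepD haY hb hc hω gs.2.1 (mB hs).1 (mB hs).2.1 (mB hs).2.2).2.2)
    (fun ω hω hs => (rep_cells hsepD haY hb hc hω gs.2.2.1 (mC hs).1 (mC hs).2.1 (mC hs).2.2).2.2)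
    (fun ω hω hs => (rep_cells hsepD haY hb hc hω gs.2.2.2.1 (mD hs).1 (mD hs).2.1 (mD hs).2.2).2.2)
    (fun ω hω hs => (rep_cells hsepD haY hb hc hω gs.2.2.2.2 (mE hs).1 (mE hs).2.1 (mE hs).2.2).2.2)
  have eS := sum_eq (q := q) h12 hsepD w wA wY hw hX hX' hY hY' (EG := {η : BondConfig V | b ∉ cl η.toFinset a ∧ c ∉ cl η.toFinset a ∧ Sep (DA ∪ DY) (cl η.toFinset a) b c}) (E := {η : BondConfig V | b ∉ cl η.toFinset a ∧ c ∉ cl η.toFinset a ∧ Sep (({s(a, h₁), s(a, h₂), s(h₁, h₂)} : Finset (Sym2 V)) ∪ DY) (cl η.toFinset a) b c})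
    (fun ω hω hs => rep_S h12 hab hac hsepD haY hb hc hbc hω gs.1 (mA hs).1 (mA hs).2.1 (mA hs).2.2)
    (fun ω hω hs => rep_S h12 hab hac hsepD haY hb hc hbc hω gs.2.1 (mB hs).1 (mB hs).2.1 (mB hs).2.2)
    (fun ω hω hs => rep_S h12 hab hac hsepD haY hb hc hbc hω gs.2.2.1 (mC hs).1 (mC hs).2.1 (mC hs).2.2)
    (fun ω hω hs => rep_S h12 hab hac hsepD haY hb hc hbc hω gs.2.2.2.1 (mD hs).1 (mD hs).2.1 (mD hs).2.2)
    (fun ω hω hs => rep_S h12 hab hac hsepD haY hb hc hbc hω gs.2.2.2.2 (mE hs).1 (mE hs).2.1 (mE hs).2.2)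
  -- the rows `B`, `E` vanish on the cells
  have hgB : ∀ e ∈ ({s(h₁, h₂)} : Set (Sym2 V)), a ∉ e := fun e he hae => by
    rw [Set.mem_singleton_iff] at he; subst he; exact (Sym2.mem_iff.1 hae).elim ha1 ha2
  have hgE : ∀ e ∈ (∅ : Set (Sym2 V)), a ∉ e := fun e he _ => he
  have cB := fun (η : BondConfig V) (hη : η ⊆ (↑DY : Set (Sym2 V))) => cells_empty_of_isolated (h₁ := h₁) (h₂ := h₂) hab hac haY hbc ({s(h₁, h₂)} : Set (Sym2 V)) hgB η hη
  have cE := fun (η : BondConfig V) (hη : η ⊆ (↑DY : Set (Sym2 V))) => cells_empty_of_isolated (h₁ := h₁) (h₂ := h₂) hab hac haY hbc (∅ : Set (Sym2 V)) hgE η hη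
  have vBT : (∑ η : BondConfig V, rcWeightW wY q ({h₁, h₂} : Set V) η * ind {η : BondConfig V | ({s(h₁, h₂)} : Set (Sym2 V)) ∪ η ∈ {η : BondConfig V | b ∈ cl η.toFinset a ∧ c ∈ cl η.toFinset a}} η) = 0 := by
    have h := row_vanish (h₁ := h₁) (h₂ := h₂) (q := q) w wY hw hY hY' ({s(h₁, h₂)} : Set (Sym2 V)) (fun _ => 1) (fun η hη => (cB η hη).1)
    simp only [mul_one] at h; exact h
  have vBUb : (∑ η : BondConfig V, rcWeightW wY q ({h₁, h₂} : Set V) η * ind {η : BondConfig V | ({s(h₁, h₂)} : Set (Sym2 V)) ∪ η ∈ {η : BondConfig V | b ∈ cl η.toFinset a ∧ c ∉ cl η.toFinset a}} η) = 0 := by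
    have h := row_vanish (h₁ := h₁) (h₂ := h₂) (q := q) w wY hw hY hY' ({s(h₁, h₂)} : Set (Sym2 V)) (fun _ => 1) (fun η hη => (cB η hη).2.1)
    simp only [mul_one] at h; exact h
  have vBUc : (∑ η : BondConfig V, rcWeightW wY q ({h₁, h₂} : Set V) η * ind {η : BondConfig V | ({s(h₁, h₂)} : Set (Sym2 V)) ∪ η ∈ {η : BondConfig V | b ∉ cl η.toFinset a ∧ c ∈ cl η.toFinset a}} η) = 0 := by
    have h := row_vanish (h₁ := h₁) (h₂ := h₂) (q := q) w wY hw hY hY' ({s(h₁, h₂)} : Set (Sym2 V)) (fun _ => 1) (fun η hη => (cB η hη).2.2.1)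
    simp only [mul_one] at h; exact h
  have vBS : (∑ η : BondConfig V, rcWeightW wY q ({h₁, h₂} : Set V) η * ind {η : BondConfig V | ({s(h₁, h₂)} : Set (Sym2 V)) ∪ η ∈ {η : BondConfig V | b ∉ cl η.toFinset a ∧ c ∉ cl η.toFinset a ∧ Sep (({s(a, h₁), s(a, h₂), s(h₁, h₂)} : Finset (Sym2 V)) ∪ DY) (cl η.toFinset a) b c}} η) = 0 := by
    have h := row_vanish (h₁ := h₁) (h₂ := h₂) (q := q) w wY hw hY hY' ({s(h₁, h₂)} : Set (Sym2 V)) (fun _ => 1) (fun η hη => (cB η hη).2.2.2)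
    simp only [mul_one] at h; exact h
  have vET : (∑ η : BondConfig V, rcWeightW wY q ({h₁, h₂} : Set V) η * (ind {η : BondConfig V | (∅ : Set (Sym2 V)) ∪ η ∈ {η : BondConfig V | b ∈ cl η.toFinset a ∧ c ∈ cl η.toFinset a}} η * (if η ∈ {η : BondConfig V | h₂ ∈ cl η.toFinset h₁} then 1 else q))) = 0 := row_vanish (h₁ := h₁) (h₂ := h₂) (q := q) w wY hw hY hY' (∅ : Set (Sym2 V)) _ (fun η hη => (cE η hη).1)
  have vEUb : (∑ η : BondConfig V, rcWeightW wY q ({h₁, h₂} : Set V) η * (ind {η : BondConfig V | (∅ : Set (Sym2 V)) ∪ η ∈ {η : BondConfig V | b ∈ cl η.toFinset a ∧ c ∉ cl η.toFinset a}} η * (if η ∈ {η : BondConfig V | h₂ ∈ cl η.toFinset h₁} then 1 else q))) = 0 := row_vanish (h₁ := h₁) (h₂ := h₂) (q := q) w wY hw hY hY' (∅ : Set (Sym2 V)) _ (fun η hη => (cE η hη).2.1)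
  have vEUc : (∑ η : BondConfig V, rcWeightW wY q ({h₁, h₂} : Set V) η * (ind {η : BondConfig V | (∅ : Set (Sym2 V)) ∪ η ∈ {η : BondConfig V | b ∉ cl η.toFinset a ∧ c ∈ cl η.toFinset a}} η * (if η ∈ {η : BondConfig V | h₂ ∈ cl η.toFinset h₁} then 1 else q))) = 0 := row_vanish (h₁ := h₁) (h₂ := h₂) (q := q) w wY hw hY hY' (∅ : Set (Sym2 V)) _ (fun η hη => (cE η hη).2.2.1)
  have vES : (∑ η : BondConfig V, rcWeightW wY q ({h₁, h₂} : Set V) η * (ind {η : BondConfig V | (∅ : Set (Sym2 V)) ∪ η ∈ {η : BondConfig V | b ∉ cl η.toFinset a ∧ c ∉ cl η.toFinset a ∧ Sep (({s(a, h₁), s(a, h₂), s(h₁, h₂)} : Finset (Sym2 V)) ∪ DY) (cl η.toFinset a) b c}} η * (if η ∈ {η : BondConfig V | h₂ ∈ cl η.toFinset h₁} then 1 else q))) = 0 := row_vanish (h₁ := h₁) (h₂ := h₂) (q := q) w wY hw hY hY' (∅ : Set (Sym2 V)) _ (fun η hη => (cE η hη).2.2.2)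
  -- assemble
  simp only [rcMeasureW_real_eq_sum_div w hq]
  rw [div_mul_div_comm, div_mul_div_comm]
  refine div_le_div_of_nonneg_right ?_ (mul_pos hZ hZ).le
  refine le_of_mul_le_mul_right (a := q ^ clusterCount (∅ : BondConfig V) ({h₁, h₂} : Set V) * q ^ clusterCount (∅ : BondConfig V) ({h₁, h₂} : Set V)) ?_ (mul_pos hK hK)
  rw [show ∀ x y K : ℝ, x * y * (K * K) = (x * K) * (y * K) from fun x y K => by ring, eT, eS,
    show ∀ x y K : ℝ, x * y * (K * K) = (x * K) * (y * K) from fun x y K => by ring, eUb, eUc,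
    vBT, vBUb, vBUc, vBS, vET, vEUb, vEUc, vES]
  have nn : ∀ (E : Set (BondConfig V)), 0 ≤ ∑ η : BondConfig V, rcWeightW wA q ({h₁, h₂} : Set V) η * ind E η := fun E =>
    Finset.sum_nonneg fun η _ => mul_nonneg (rcWeightW_nonneg wA hq.le _ η) (ind_nonneg E η)
  exact theta_quadratic_le (nn {η : BondConfig V | h₁ ∈ cl η.toFinset a ∧ h₂ ∈ cl η.toFinset a}) (nn {η : BondConfig V | h₁ ∈ cl η.toFinset a ∧ h₂ ∉ cl η.toFinset a}) (nn {η : BondConfig V | h₁ ∉ cl η.toFinset a ∧ h₂ ∈ cl η.toFinset a}) hQA hQC hQD hW0 hW1 hCR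

end Main

end HubPairApex

end Summit.CriticalPhenomena.PercolationContinuityZ3.Theorems
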